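import Summits.RiemannHypothesis.RiemannHypothesis.Theorems.PfPersistenceTallyTwin
import Summits.RiemannHypothesis.RiemannHypothesis.Theorems.GroundBartaPolarPerronFrobeniusThetaQuasimode
import HarnessLib

/-!
# PF persistence — W2 ON THE TALLY DOMAIN WITHOUT `DialReady`: small even up-dials at large primes accumulate at `ζ`
(pub-rhpf barrier-typer gen 5, part 2 of 2; CLASS.md §4.3 W2, CASE-DAG B-W2 / B-TYPED-2, lead g9 GAL division)

**HONEST FRAMING. This is a long-odds MECHANISM SEARCH; no RH claims.** RH-free bookkeeping between the cell's
Galerkin records and the continuum model, modulo the ONE typed density input `TestToProfileSupDensity` (part 1).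
RH appears only inside a `by_cases` of a proof whose statement does not mention it, or as an explicit hypothesis of a
corollary labelled conditional.

## What is proved (modulo `TestToProfileSupDensity` only)

* `exists_dial_form_neg_of_twin_margin` — the GALERKIN TRANSFER: if the even twin `g` of a real even test `g₁` on
  `[-b, b]` (`2b < log p`) has the dial margin `Re Q_ζ(g) < 2t·w(p)·‖g₁‖²`, then at the window `a = log p/2 + b` some
  served vector makes the even block of the dial `K = 1 + t` at `p` negative.  Mechanism: the dialled form is
  `vᵀζv − 2(K−1)w(p)·autocorr_v(log p)` (`evenBlock_dial_eq`, `primePattern_form_eq_autocorr`); the sup density moves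
  the `ζ`-form (closed-form conjunct, `galerkinForm_eq_markovClosedForm`, `re_weilQuadratic_eq_markovClosedForm`) and
  the autocorrelation value (`abs_autocorr_sub_integral_le`, `integral_re_twin_mul_shift`).
* `negativesAccumulateNe_arithDialSpace_of_weilPositivity` — IF `ζ` is Weil-positive on every window THEN the
  detectably negative members of the ARITHMETIC dial space other than `ζ` accumulate at `ζ` uniformly: for every
  `ε > 0` the UP-dial `K = 1 + ε/(4w(p))` at a LARGE prime `p` is arithmetic, `≠ ζ`, uniformly `ε/2`-close and
  detectably negative (near-minimiser `g₁` on `[-b, b]` with `ε_ev(b) ≤ exp(−3e^{2b})` by the RH-free EVEN UPPER LAW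
  `weilEvenGroundEnergy_le_exp_neg_mul_exp`, then F5-A via `re_weilQuadratic_twin_lt`).
* `not_riemannHypothesis_or_negativesAccumulateNe_arithDialSpace` — RH-FREE DICHOTOMY: either `ζ`'s own datum is
  detectably negative (and RH fails), or the arithmetic negatives accumulate at `ζ`.
* `not_separates_of_uniformlyRobust_tally` — **W2 ON THE TALLY, `DialReady`-FREE**: no `τ_unif`-robust criterion at
  `ζ` separates `ζ` from the negatives of any domain containing `arithDialSpace`.  (The wall of record,
  `not_separates_of_uniformlyRobust_arith`, needed the fixed-prime DATA input `DialReady p β₀`; that input now only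
  serves the observatory's `p = 2` leaf, not the wall.)

References: E. Bombieri, Rend. Mat. Acc. Lincei (9) 11 (2000) §4; A. Connes, C. Consani, arXiv:2106.01715 Lemma 2.6
(the `θ`-kernel behind the even upper law); the cell files cited by name above.
-/

set_option linter.dupNamespace false

noncomputable section

open Real MeasureTheory Set Matrix Filter
open scoped Topology ComplexConjugate
open Literature.NumberTheory.LFunctions
open Summit.RiemannHypothesis.RiemannHypothesis.Theorems.PfPersistenceF5TailTwins

namespace Summit.RiemannHypothesis.RiemannHypothesis.Theorems.PfPersistence

/-! ## §8 The Galerkin step: a negative even test with a dial margin gives a negative dialled window vector -/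

/-- PROVED (the transfer, modulo the SUP density): let `p` be prime, `0 < b`, `2b < log p`, `a = log p/2 + b`,
`t > 0`, and let `g₁` be a smooth even REAL test on `[-b, b]` whose even twin `g` satisfies the margin
`Re Q_ζ(g) < 2t·w(p)·‖g₁‖²`.  Then some served vector `v` at some truncation `N` of the window `a` makes the even
block of the dial `K = 1 + t` at `p` negative: `vᵀ Q_{dial}(a, N) v < 0`. [folklore] -/
theorem exists_dial_form_neg_of_twin_margin (hD : TestToProfileSupDensity) {p : ℕ} (hp : p.Prime) {t b : ℝ}
    (ht : 0 < t) (hb : 0 < b) (hb2 : 2 * b < Real.log p) {g₁ : ℝ → ℂ} (hg : IsWeilTest g₁)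
    (hs : tsupport g₁ ⊆ Icc (-b) b) (hev : ∀ x, g₁ (-x) = g₁ x) (hre : ∀ x, (g₁ x).im = 0)
    (hmargin : (weilQuadratic (twin (Real.log p / 2) (-1) g₁)).re
      < 2 * t * zetaWeights p * ∫ x, ‖g₁ x‖ ^ 2) :
    ∃ (win : Window) (v : Fin (win.N + 1) → ℝ), win.a = Real.log p / 2 + b ∧
      v ⬝ᵥ (datumOf (dial p (1 + t) zetaWeights) win *ᵥ v) < 0 := by
  set c : ℝ := Real.log p / 2 with hc_def
  have hc0 : 0 < c := by rw [hc_def]; linarith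
  have hbc : b < c := by rw [hc_def]; linarith
  have hc2 : Real.log p = 2 * c := by rw [hc_def]; ring
  have ha : 0 < c + b := by linarith
  set g : ℝ → ℂ := twin c (-1) g₁ with hg_def
  have hgt : IsWeilTest g := isWeilTest_twin hg c (-1)
  have hgs : tsupport g ⊆ Icc (-(c + b)) (c + b) := tsupport_twin_subset hs hc0.le (-1)
  have hgev : ∀ x, g (-x) = g x := twin_even hev c
  have hgre : ∀ x, (g x).im = 0 := twin_im_eq_zero hre c
  -- sup bound of the real twin
  obtain ⟨M, hMb⟩ := hgt.1.continuous.bounded_above_of_compact_support hgt.2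
  have hM : ∀ x, |(g x).re| ≤ M := fun x => (Complex.abs_re_le_norm _).trans (hMb x)
  have hM0 : 0 ≤ M := (abs_nonneg _).trans (hM 0)
  -- the margin and the accuracy `δ`
  set m : ℝ := ∫ x, ‖g₁ x‖ ^ 2 with hm_def
  set w : ℝ := zetaWeights p with hw_def
  have hw : 0 < w := zetaWeights_pos_of_prime hp
  set μ : ℝ := 2 * t * w * m - (weilQuadratic g).re with hμ_def
  have hμ : 0 < μ := by rw [hμ_def]; linarith
  set D : ℝ := 1 + 2 * t * w * (2 * (c + b)) * (2 * M + 1) with hD_def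
  have hD0 : 0 < D := by
    have : 0 ≤ 2 * t * w * (2 * (c + b)) * (2 * M + 1) := by positivity
    linarith
  set δ : ℝ := min 1 (μ / (2 * D)) with hδ_def
  have hδpos : 0 < δ := lt_min one_pos (by positivity)
  have hδ1 : δ ≤ 1 := min_le_left _ _
  have hδμ : δ * D ≤ μ / 2 := by
    have : δ ≤ μ / (2 * D) := min_le_right _ _
    calc δ * D ≤ μ / (2 * D) * D := mul_le_mul_of_nonneg_right this hD0.le
      _ = μ / 2 := by field_simp
  -- the sup density at accuracy `δ`
  obtain ⟨N, v, hsup, -, hform⟩ := hD (c + b) ha g hgt hgs hgev hgre δ hδpos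
  set win : Window := ⟨c + b, N, ha⟩ with hwin_def
  refine ⟨win, v, by rw [hc_def], ?_⟩
  -- (1) the `ζ`-form of `v` is within `δ` of `Re Q_ζ(g)`
  have hζ : v ⬝ᵥ (zetaDatum win *ᵥ v) ≤ (weilQuadratic g).re + δ := by
    have h1 := galerkinForm_eq_markovClosedForm win v
    have h2 := re_weilQuadratic_eq_markovClosedForm hgt hgs
    have := (abs_le.1 hform).2
    rw [← h1] at this
    linarith
  -- (2) the autocorrelation of `θ_v` at lag `log p` is within `2a·δ(2M+δ)` of the mass `m`
  have hclose : ∀ x ∈ Icc (-(c + b)) (c + b), |profile (2 * (c + b)) v x - (g x).re| ≤ δ := by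
    intro x hx
    have h := hsup x
    have hcut : cutoffProfile win v x = ((profile (2 * (c + b)) v x : ℝ) : ℂ) := by
      simp only [cutoffProfile, hwin_def, Set.indicator_of_mem hx]
    rw [hcut] at h
    have := Complex.abs_re_le_norm (((profile (2 * (c + b)) v x : ℝ) : ℂ) - g x)
    rw [Complex.sub_re, Complex.ofReal_re] at this
    exact this.trans h
  have hcont : Continuous fun x => (g x).re := Complex.continuous_re.comp hgt.1.continuous
  have hauto := abs_autocorr_sub_integral_le (a := c + b) v hcont hδpos.le hM hclose
    (y := Real.log p) (by rw [hc2]; linarith) (by rw [hc2]; linarith)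
  have hint : ∫ x in (-(c + b))..(c + b - Real.log p), (g x).re * (g (x + Real.log p)).re = m := by
    rw [hc2]; exact integral_re_twin_mul_shift hg hs hb hbc hre
  rw [hint] at hauto
  have hauto' : m - 2 * (c + b) * (δ * (2 * M + δ)) ≤ autocorr (2 * (c + b)) v (Real.log p) := by
    have := (abs_le.1 hauto).1; linarith
  -- (3) the dialled form in closed form
  have hpr : p ∈ primeRange (2 * win.a) := mem_primeRange_of_log_le (by simp [hwin_def, hc2]; linarith)
  have hPp : v ⬝ᵥ (primePattern p win *ᵥ v) = autocorr (2 * (c + b)) v (Real.log p) :=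
    primePattern_form_eq_autocorr win.ha p v
  have hdial : v ⬝ᵥ (datumOf (dial p (1 + t) zetaWeights) win *ᵥ v)
      = v ⬝ᵥ (zetaDatum win *ᵥ v) - 2 * t * w * autocorr (2 * (c + b)) v (Real.log p) := by
    simp only [datumOf]
    rw [evenBlock_dial_eq hpr, Matrix.sub_mulVec, dotProduct_sub, Matrix.smul_mulVec, dotProduct_smul,
      smul_eq_mul, hPp, show (1 + t - 1 : ℝ) = t by ring]
    rfl
  -- (4) arithmetic
  rw [hdial]
  have htw0 : 0 ≤ 2 * t * w := by positivity
  have hstep : 2 * t * w * (m - 2 * (c + b) * (δ * (2 * M + δ)))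
      ≤ 2 * t * w * autocorr (2 * (c + b)) v (Real.log p) := mul_le_mul_of_nonneg_left hauto' htw0
  have herr : δ * (2 * M + δ) ≤ δ * (2 * M + 1) := mul_le_mul_of_nonneg_left (by linarith) hδpos.le
  have herr' : 2 * t * w * (2 * (c + b) * (δ * (2 * M + δ))) ≤ 2 * t * w * (2 * (c + b)) * (2 * M + 1) * δ := by
    have : 2 * t * w * (2 * (c + b) * (δ * (2 * M + δ))) = (2 * t * w * (2 * (c + b))) * (δ * (2 * M + δ)) := by
      ring
    rw [this]
    have h4 : 0 ≤ 2 * t * w * (2 * (c + b)) := by positivity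
    calc (2 * t * w * (2 * (c + b))) * (δ * (2 * M + δ)) ≤ (2 * t * w * (2 * (c + b))) * (δ * (2 * M + 1)) :=
          mul_le_mul_of_nonneg_left herr h4
      _ = 2 * t * w * (2 * (c + b)) * (2 * M + 1) * δ := by ring
  have hsum : δ + 2 * t * w * (2 * (c + b)) * (2 * M + 1) * δ = δ * D := by rw [hD_def]; ring
  nlinarith [hζ, hstep, herr', hsum, hδμ, hμ]

/-! ## §9 W2 ON THE TALLY DOMAIN, `DialReady`-FREE -/

/-- **PROVED (modulo the SUP density; conditional on window positivity of `ζ`, which RH implies — no RH claim):**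
if `ζ` is Weil-positive on every window, the detectably negative ARITHMETIC data other than `ζ` accumulate at `ζ`
uniformly: small even UP-dials `K = 1 + ε/(4 w(p))` at large primes `p`. [folklore] -/
theorem negativesAccumulateNe_arithDialSpace_of_weilPositivity (hD : TestToProfileSupDensity)
    (hW : ∀ a : ℝ, 0 < a → WeilPositivityOn a) : NegativesAccumulateNe arithDialSpace zetaDatum := by
  intro ε hε
  have hε16 : 0 < ε / 16 := by positivity
  -- (a) the even upper law: `ε_ev(b) ≤ exp(-3 e^{2b})` for `b ≥ a₀`
  obtain ⟨a₀, ha₀⟩ := PolarPerronFrobenius.weilEvenGroundEnergy_le_exp_neg_mul_exp (c := 3)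
    (by linarith [Real.pi_gt_three])
  have h2 : Tendsto (fun b : ℝ => 2 * b) atTop atTop := tendsto_id.const_mul_atTop two_pos
  have h3 : Tendsto (fun b : ℝ => 3 * rexp (2 * b)) atTop atTop :=
    (Real.tendsto_exp_atTop.comp h2).const_mul_atTop three_pos
  have h4 : Tendsto (fun b : ℝ => -(3 * rexp (2 * b))) atTop atBot := tendsto_neg_atTop_atBot.comp h3
  have hT : Tendsto (fun b : ℝ => rexp (-(3 * rexp (2 * b)))) atTop (𝓝 0) := Real.tendsto_exp_atBot.comp h4
  obtain ⟨b, hbT, hba₀, hb1⟩ :=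
    ((hT.eventually (gt_mem_nhds hε16)).and ((eventually_ge_atTop a₀).and (eventually_ge_atTop 1))).exists
  have hb : 0 < b := by linarith
  set E : ℝ := 2 * rexp (-(3 * rexp (2 * b))) with hE_def
  have hEpos : 0 < rexp (-(3 * rexp (2 * b))) := Real.exp_pos _
  have hEev : weilEvenGroundEnergy b < E := by
    have := ha₀ b hba₀
    rw [hE_def]; linarith
  have hEε : E < ε / 8 := by rw [hE_def]; linarith
  -- (b) a real even near-minimiser on `[-b, b]`
  obtain ⟨g₁, hg, hs, hev, hre, hm, hq⟩ := exists_even_real_test_rayleigh_lt hb hEev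
  -- (c) a prime beyond `e^{2b}`
  obtain ⟨p, hpge, hp⟩ := Nat.exists_infinite_primes (⌊rexp (2 * b)⌋₊ + 1)
  have hp0 : (0 : ℝ) < p := by exact_mod_cast hp.pos
  have hpexp : rexp (2 * b) < p := by
    have h1 : rexp (2 * b) < (⌊rexp (2 * b)⌋₊ : ℝ) + 1 := Nat.lt_floor_add_one _
    have h2 : ((⌊rexp (2 * b)⌋₊ + 1 : ℕ) : ℝ) ≤ p := by exact_mod_cast hpge
    push_cast at h2
    linarith
  have hb2 : 2 * b < Real.log p := by rwa [Real.lt_log_iff_exp_lt hp0]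
  -- (d) the dial: `w = w(p) = log p/√p`, `t = ε/(4w)`, `K = 1 + t`
  set w : ℝ := zetaWeights p with hw_def
  have hw : 0 < w := zetaWeights_pos_of_prime hp
  have hw' : w = Real.log p / Real.sqrt p := zetaWeights_prime hp
  set t : ℝ := ε / (4 * w) with ht_def
  have ht : 0 < t := by positivity
  have htw : t * w = ε / 4 := by rw [ht_def]; field_simp
  -- (e) the continuum margin from F5-A under window positivity
  have hmargin : (weilQuadratic (twin (Real.log p / 2) (-1) g₁)).re < 2 * t * zetaWeights p * ∫ x, ‖g₁ x‖ ^ 2 := by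
    have h := re_weilQuadratic_twin_lt hp ht hb hb2 (hW _ (by linarith)) hg hs hq.le hm (E := E)
      (by rw [mul_div_assoc, ← hw', htw]; linarith)
    rwa [← hw'] at h
  -- (f) the Galerkin transfer
  obtain ⟨win, v, -, hneg⟩ := exists_dial_form_neg_of_twin_margin hD hp ht hb hb2 hg hs hev hre hmargin
  refine ⟨datumOf (dial p (1 + t) zetaWeights), datumOf_dial_zeta_mem_arithDialSpace p (1 + t), ?_, ⟨win, v, hneg⟩, ?_⟩
  · exact datumOf_dial_ne hp.two_le (by linarith) hw.ne'
  · have hclose : UniformlyClose (2 * |1 + t - 1| * |zetaWeights p|) zetaDatum (datumOf (dial p (1 + t) zetaWeights)) :=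
      uniformlyClose_dial_of_boundedOn (fun win hp v => primePattern_form_abs_le win.ha hp v) (1 + t) zetaWeights
    refine hclose.of_le ?_
    rw [show (1 + t - 1 : ℝ) = t by ring, abs_of_pos ht, ← hw_def, abs_of_pos hw]
    linarith

/-- **PROVED — CONDITIONAL COROLLARY (RH as an explicit hypothesis; no RH claim):** under RH (hence Weil positivity on
every window, `weil_criterion_holds`), the arithmetic negatives accumulate at `ζ` (modulo the SUP density). [folklore] -/
theorem negativesAccumulateNe_arithDialSpace_of_riemannHypothesis (hD : TestToProfileSupDensity)
    (hRH : RiemannHypothesis) : NegativesAccumulateNe arithDialSpace zetaDatum :=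
  negativesAccumulateNe_arithDialSpace_of_weilPositivity hD fun a ha =>
    weilPositivityOn_of_riemannHypothesis weil_criterion_holds hRH a ha

/-- **PROVED — RH-FREE DICHOTOMY (modulo the SUP density):** either `ζ`'s own datum is detectably negative (and RH
fails), or the detectably negative arithmetic data other than `ζ` accumulate at `ζ` uniformly. [folklore] -/
theorem not_riemannHypothesis_or_negativesAccumulateNe_arithDialSpace (hD : TestToProfileSupDensity) :
    (¬ RiemannHypothesis ∧ DetectablyNegative zetaDatum) ∨ NegativesAccumulateNe arithDialSpace zetaDatum := by
  by_cases hRH : RiemannHypothesis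
  · exact Or.inr (negativesAccumulateNe_arithDialSpace_of_riemannHypothesis hD hRH)
  · exact Or.inl ⟨hRH, detectablyNegative_zeta_of_not_riemannHypothesis (testToGalerkinFormDensity_of_sup hD) hRH⟩

/-- **PROVED — W2 ON THE TALLY DOMAIN, `DialReady`-FREE (RH-free; modulo the SUP density only):** no criterion that
is `τ_unif`-robust at `ζ` separates `ζ` from the detectably negative members of any domain containing the ARITHMETIC
dial space.  (Either `ζ` is itself detectably negative, or a robust neighbourhood of `ζ` contains a negative
arithmetic dial.) [folklore] -/
theorem not_separates_of_uniformlyRobust_tally (hD : TestToProfileSupDensity) {S D : Set Datum}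
    (hDs : arithDialSpace ⊆ D) (hS : UniformlyRobustAt S zetaDatum) : ¬ Separates S D zetaDatum := by
  intro hsep
  rcases not_riemannHypothesis_or_negativesAccumulateNe_arithDialSpace hD with ⟨-, hneg⟩ | hacc
  · exact hsep.2 zetaDatum (hDs zetaDatum_mem_arithDialSpace) hneg hsep.1
  · obtain ⟨d, hd, -, hdS, hdneg⟩ := not_uniformlyRobust_of_negativesAccumulateNe hacc hS
    exact hsep.2 d (hDs hd) hdneg hdS

/-- **PROVED — the wall at the two domains of record** (`arithDialSpace` itself and the full `dialSpace`). [folklore] -/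
theorem not_separates_arith_of_uniformlyRobust (hD : TestToProfileSupDensity) {S : Set Datum}
    (hS : UniformlyRobustAt S zetaDatum) :
    ¬ Separates S arithDialSpace zetaDatum ∧ ¬ Separates S dialSpace zetaDatum :=
  ⟨not_separates_of_uniformlyRobust_tally hD subset_rfl hS,
    not_separates_of_uniformlyRobust_tally hD arithDialSpace_subset_dialSpace hS⟩

end Summit.RiemannHypothesis.RiemannHypothesis.Theorems.PfPersistence

end
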